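import Summits.QuantumFields.BalabanUV.Beta.GAN24.WilsonVertexSumZero
import Summits.QuantumFields.BalabanUV.Beta.GAN24.AliasStripSymbols

/-!
# `BalabanUV.Beta.GAN24.WilsonVertexSymbol` — register tag «ALIAS-SYMBOL-VH* part 3 = WILSON-PLANE*» (typer T-E6 (u2), LEAVES v2.9.3;
# feeds SKELETON-S3 v0.3 §8 I-L3(b) sub-leaf `wilsonA_symbol`, prospective cut R5 ∕ input of R8): THE PLANE-WAVE BI-SYMBOL OF THE
# COLOURLESS WILSON FIRST-ORDER VERTEX TABLE `StepJetData.wEntry ∕ wilsonA` as an explicit finite exponential sum over an3's stencil index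

NOT IN PRINT; OUR PROOF ATTEMPT (row G-an2-4 ∕ (CONV-C), S-slot remainder «E3Shape»; THIS file is [folklore] finite trigonometric algebra
over the TREE's `PlaquetteStencilData.wilsonVertex₁_apply` — an3's theorem that the Wilson first-order vertex IS ONE finite stencil with
SITE-INDEPENDENT data `wα`, `wβ`, `wm` and offsets in the alphabet `{0, e_γ, ±e_μ, e_γ − e_μ}` — and road P1's plane waves `FibreSymbols.pw`).
HONEST FRAMING (cell contract, verbatim): «discharging `BetaPertH` makes Bałaban's UV stability UNCONDITIONAL — a real constructive-QFT result;
it is NOT the continuum limit and NOT the Clay problem.»  HONEST DEPENDENCY (verbatim): «continuum YM on T⁴ ⇐ BetaPertH ∧ nine spine estimates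
(0/9 proved); BetaPertH ⇐ (D1) ∧ (D4) ∧ CAP+tail; G-an2-4 gates asym, D1 and NE2/3/4.»  No cited fact, no `def … : Prop`, nothing asserted about
«E3Shape»∕«E3SupRate» or the size of `e3Of`; generic `d`; every unit and sign convention left symbolic (the owner's (PC-1) placement and momentum
sign are NOT pre-empted: `wSym` is stated at two INDEPENDENT complex momenta `k`, `k′`, so any convention is a substitution).  NOT summit progress.

## What is proved (generic `d`, `D = d+1`, background bond `(κ′, u)`, fibre directions `α β`, complex momenta `k k′ : Fin (d+1) → ℂ`)
* §1 (in `GAN24/WilsonVertexSumZero`, BY NAME): `wc κ′ i α β` — the colourless block entry of stencil index `i : WilsonIdx (Fin (d+1))`;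
  `wEntry_eq_sum` — an entry of the table is the indicator sum `Σ_i [x = u + wα i][z = u + wβ i]·wc κ′ i α β` (`wilsonVertex₁_apply`).
* §2 **`wSym κ′ α β k k′ := Σ_i wc κ′ i α β · pw k (wα i) · pw k′ (wβ i)`** — THE PLANE-WAVE BI-SYMBOL, an explicit finite exponential sum —
  and **`wEntry_plane`**: for all finite `S, T ⊇ u + offsets`, `Σ_{x∈S} Σ_{z∈T} wEntry d κ′ u x z α β · pw k x · pw k′ z = pw k u · pw k′ u · wSym κ′ α β k k′`
  (fine translation covariance visible as the prefactor `e^{i(k+k′)·u}`; no alias mixing of its own).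
* §3 **`wilsonA_plane`**: the ANTISYMMETRISED field block (`StepJetData.wilsonA`, the physical (V-Δ) table) pairs to
  `pw k u · pw k′ u · ½·(wSym κ′ α β k k′ − wSym κ′ β α k′ k)`; the multiplier blocks pair to `0`.
* §4 THE (PC-3) DISPLAY, exactly what the stencil gives and no more: from `WilsonVertexSumZero.sum_wc_eq_zero` (the colour blocks of an3's
  vertex sum to zero — leaf-18-g10's `ProbeWilsonCurl.lean` §1 chain, re-derived there WITH CREDIT), **`wSym_zero_zero : wSym κ′ α β 0 0 = 0`** (the cubic Wilson vertex annihilates the pair of constant fields) and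
  **`wSym_eq_sum_sub_one : wSym κ′ α β k k′ = Σ_i wc κ′ i α β · (pw k (wα i) · pw k′ (wβ i) − 1)`** — every summand carries ONE exponential
  difference over an offset pair of ℓ¹-size ≤ 2 + 2, i.e. the symbol lies in the ideal generated by `{e^{ik_μ} − 1, e^{ik′_μ} − 1}_μ` (JOINT
  vanishing at `(k,k′) = (0,0)` — the symbol side of leaf-18-g10's Abel-summation gain `wilsonA_pairing_le`).  Whether a difference factors
  on ONE prescribed leg is NOT asserted globally; it is read off the constituents:
* (§5, the four constituents `wSymCur ∕ wSymSpin ∕ wSymDiv ∕ wSymRem` with closed forms, is the companion module `WilsonVertexSymbolParts`.)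
* §6 STRIP BOUNDS: `norm_pw_le_exp` (`‖pw k x‖ ≤ e^{η·|x|₁}` for `|Im k_μ| ≤ η`), `wAbs κ′ α β := Σ_i |wc κ′ i α β| ≤ wBound d`, and
  **`norm_wSym_le`**: `‖wSym κ′ α β k k′‖ ≤ wAbs κ′ α β · e^{2η} · e^{2η′}` on `|Im k_μ| ≤ η`, `|Im k′_μ| ≤ η′` (offsets have `|·|₁ ≤ 2`,
  `StepJetData.l1_isOffset_le`); jointly entire (finite exponential sum) — packaging into `StripRegular₂` is the packer's, BY NAME.
* §6b THE CURL GAIN AT THE SYMBOL LEVEL: `norm_pw_mul_pw_sub_one_le` and **`norm_wSym_le_linear`**: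
  `‖wSym κ′ α β k k′‖ ≤ 4·wAbs κ′ α β·(‖k‖ + ‖k′‖)·e^{2η+2η′}` on the strip — FIRST ORDER in the pair of momenta; on the zero alias `k = p∕N`,
  `k′ = p′∕N` this is the one factor `N⁻¹` of (PC-2)'s count, as a kernel inequality with a displayed constant.
Unit `b2b-balaban-gan24-formalise-leaf-15` (gen 13, idle swarm seat; INTENT CLAIMS.log l.4373), 2026-08-20.  v4 (imports leaf W1 for §1∕§4's shared
declarations; filed per the row owner's RULINGS-5 «go», CLAIMS l.4559).
-/

noncomputable section

open Complex Finset
open scoped BigOperators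
open Literature.MathematicalPhysics.QuantumFieldTheory.Balaban1983to89
open Literature.MathematicalPhysics.QuantumFieldTheory.Balaban1983to89.Beta
open B12Sec2to5 (l1 l1_nonneg)
open B6BondElimination (unitVec unitVec_apply)
open PlaquetteStencilData (WilsonIdx RemIdx wα wβ wm IsOffset wilsonVertex₁_apply isOffset_wα isOffset_wβ fam trm dim bsm rmm
  dvm)
open GhostTable (curM copies)
open SpinTable (spM)
open StepJetData (wEntry wilsonA wBound l1_isOffset_le)
open OneStepResolventKernel (Fib)
open Summit.QuantumFields.BalabanUV.Beta.GAN24.FibreSymbols (pw pw_add)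
open Summit.QuantumFields.BalabanUV.Beta.GAN24.AliasStripSymbols (norm_cexp_I_mul_le)
open Summit.QuantumFields.BalabanUV.Beta.GAN24.WilsonVertexSumZero (uv wc wEntry_eq_sum sum_wm_eq_zero sum_wc_eq_zero)

namespace Summit.QuantumFields.BalabanUV.Beta.GAN24.WilsonVertexSymbol

variable {d : ℕ}

/- `uv`, `wc`, `wEntry_eq_sum` (the colourless block entries and the indicator form of a table entry) and the block-sum chain
   `sum_fam … sum_wm_eq_zero`, `sum_wc_eq_zero` LIVE IN `GAN24/WilsonVertexSumZero` (leaf W1, p205867) and are used BY NAME. -/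

/-! ## §2 The plane-wave bi-symbol and the pairing identity -/

/-- [folklore] **THE PLANE-WAVE BI-SYMBOL OF THE COLOURLESS WILSON TABLE** at the background direction `κ′`, fibre directions `α, β` and
two independent complex momenta `k, k′`: the finite exponential sum `Σ_i wc κ′ i α β · e^{ik·wα i} · e^{ik′·wβ i}` over an3's stencil index. -/
def wSym (κ' α β : Fin (d + 1)) (k k' : Fin (d + 1) → ℂ) : ℂ :=
  ∑ i, (wc κ' i α β : ℂ) * pw k (wα uv κ' i) * pw k' (wβ uv κ' i)

/-- [folklore] the located double sum of one indicator against two weights. -/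
theorem sum_sum_ite_mul {X : Type*} [DecidableEq X] {S T : Finset X} {a b : X} (ha : a ∈ S) (hb : b ∈ T) (c : ℂ)
    (f g : X → ℂ) : ∑ x ∈ S, ∑ z ∈ T, (if x = a ∧ z = b then c else 0) * f x * g z = c * f a * g b := by
  rw [Finset.sum_eq_single_of_mem a ha]
  · rw [Finset.sum_eq_single_of_mem b hb]
    · simp
    · intro z _ hz
      rw [if_neg (fun h => hz h.2), zero_mul, zero_mul]
  · intro x _ hx
    exact Finset.sum_eq_zero fun z _ => by rw [if_neg (fun h => hx h.1), zero_mul, zero_mul]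

/-- [folklore] **THE PAIRING IDENTITY**: for all finite `S ⊇ u + row offsets`, `T ⊇ u + column offsets`,
`Σ_{x∈S} Σ_{z∈T} wEntry d κ′ u x z α β · pw k x · pw k′ z = pw k u · pw k′ u · wSym κ′ α β k k′`. -/
theorem wEntry_plane (κ' : Fin (d + 1)) (u : Fin (d + 1) → ℤ) (α β : Fin (d + 1)) (S T : Finset (Fin (d + 1) → ℤ))
    (hS : ∀ i, u + wα uv κ' i ∈ S) (hT : ∀ i, u + wβ uv κ' i ∈ T) (k k' : Fin (d + 1) → ℂ) :
    ∑ x ∈ S, ∑ z ∈ T, (wEntry d κ' u x z α β : ℂ) * pw k x * pw k' z = pw k u * pw k' u * wSym κ' α β k k' := by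
  have h1 : ∀ x z, ((wEntry d κ' u x z α β : ℝ) : ℂ) * pw k x * pw k' z =
      ∑ i, (if x = u + wα uv κ' i ∧ z = u + wβ uv κ' i then (wc κ' i α β : ℂ) else 0) * pw k x * pw k' z := by
    intro x z
    rw [wEntry_eq_sum]
    push_cast
    rw [Finset.sum_mul, Finset.sum_mul]
    refine Finset.sum_congr rfl fun i _ => ?_
    split_ifs <;> simp
  have h2 : ∀ x ∈ S, ∑ z ∈ T, ((wEntry d κ' u x z α β : ℝ) : ℂ) * pw k x * pw k' z =
      ∑ i, ∑ z ∈ T, (if x = u + wα uv κ' i ∧ z = u + wβ uv κ' i then (wc κ' i α β : ℂ) else 0) * pw k x * pw k' z := by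
    intro x _
    rw [Finset.sum_congr rfl (fun z _ => h1 x z), Finset.sum_comm]
  rw [Finset.sum_congr rfl h2, Finset.sum_comm, wSym, Finset.mul_sum]
  refine Finset.sum_congr rfl fun i _ => ?_
  rw [sum_sum_ite_mul (hS i) (hT i), pw_add, pw_add]
  ring

/-! ## §3 The antisymmetrised (physical) field block and the multiplier blocks -/

/-- [folklore] **THE PAIRING OF THE (V-Δ) FIELD BLOCK** `wilsonA d κ′ u` (antisymmetrised colourless table): for every finite `S` containing
`u +` all row and column offsets, `Σ_{x∈S} Σ_{z∈S} wilsonA d κ′ u x z (inl α) (inl β) · pw k x · pw k′ z =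
pw k u · pw k′ u · ½·(wSym κ′ α β k k′ − wSym κ′ β α k′ k)`. -/
theorem wilsonA_plane (κ' : Fin (d + 1)) (u : Fin (d + 1) → ℤ) (α β : Fin (d + 1)) (S : Finset (Fin (d + 1) → ℤ))
    (hSα : ∀ i, u + wα uv κ' i ∈ S) (hSβ : ∀ i, u + wβ uv κ' i ∈ S) (k k' : Fin (d + 1) → ℂ) :
    ∑ x ∈ S, ∑ z ∈ S, (wilsonA d κ' u x z (Sum.inl α) (Sum.inl β) : ℂ) * pw k x * pw k' z =
      pw k u * pw k' u * ((1 / 2) * (wSym κ' α β k k' - wSym κ' β α k' k)) := by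
  have h1 : ∀ x z, wilsonA d κ' u x z (Sum.inl α) (Sum.inl β) = 1 / 2 * (wEntry d κ' u x z α β - wEntry d κ' u z x β α) :=
    fun _ _ => rfl
  have hA := wEntry_plane κ' u α β S S hSα hSβ k k'
  have hB : ∑ x ∈ S, ∑ z ∈ S, (wEntry d κ' u z x β α : ℂ) * pw k x * pw k' z = pw k u * pw k' u * wSym κ' β α k' k := by
    rw [Finset.sum_comm]
    have hB' := wEntry_plane κ' u β α S S hSα hSβ k' k
    rw [mul_comm (pw k' u) (pw k u)] at hB'
    rw [← hB']
    exact Finset.sum_congr rfl fun x _ => Finset.sum_congr rfl fun z _ => by ring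
  simp_rw [h1]
  push_cast
  have h2 : ∀ x z, (1 / 2 * ((wEntry d κ' u x z α β : ℂ) - (wEntry d κ' u z x β α : ℂ))) * pw k x * pw k' z =
      1 / 2 * ((wEntry d κ' u x z α β : ℂ) * pw k x * pw k' z) - 1 / 2 * ((wEntry d κ' u z x β α : ℂ) * pw k x * pw k' z) := by
    intro x z; ring
  simp_rw [h2, Finset.sum_sub_distrib, ← Finset.mul_sum]
  rw [hA, hB]
  ring

/-- [folklore] the multiplier blocks of `wilsonA` vanish identically, hence pair to `0`. -/
theorem wilsonA_inl_inr (κ' : Fin (d + 1)) (u x z : Fin (d + 1) → ℤ) (α μ : Fin (d + 1)) :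
    wilsonA d κ' u x z (Sum.inl α) (Sum.inr μ) = 0 := rfl

/-- [folklore] the multiplier blocks of `wilsonA` vanish identically. -/
theorem wilsonA_inr (κ' : Fin (d + 1)) (u x z : Fin (d + 1) → ℤ) (μ : Fin (d + 1)) (b : Fib d) :
    wilsonA d κ' u x z (Sum.inr μ) b = 0 := by cases b <;> rfl

/-! ## §4 The (PC-3) display: the blocks sum to zero ⇒ joint vanishing at zero momenta, one exponential difference per summand -/

/-- [folklore] **THE SYMBOL VANISHES AT THE PAIR OF ZERO MOMENTA**: `wSym κ′ α β 0 0 = 0` — the cubic Wilson vertex annihilates the pair of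
constant fluctuation fields. -/
theorem wSym_zero_zero (κ' α β : Fin (d + 1)) : wSym κ' α β 0 0 = 0 := by
  have h : ∀ x : Fin (d + 1) → ℤ, pw (0 : Fin (d + 1) → ℂ) x = 1 := fun x => by simp [pw]
  simp only [wSym, h, mul_one]
  have h0 := congrArg (fun r : ℝ => (r : ℂ)) (sum_wc_eq_zero κ' α β)
  push_cast at h0
  exact h0

/-- [folklore] **ONE EXPONENTIAL DIFFERENCE PER SUMMAND**: `wSym κ′ α β k k′ = Σ_i wc κ′ i α β · (pw k (wα i) · pw k′ (wβ i) − 1)` — the symbol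
lies in the ideal generated by the single-coordinate differences `e^{ik_μ} − 1`, `e^{ik′_μ} − 1` (both offsets have ℓ¹-size ≤ 2). -/
theorem wSym_eq_sum_sub_one (κ' α β : Fin (d + 1)) (k k' : Fin (d + 1) → ℂ) :
    wSym κ' α β k k' = ∑ i, (wc κ' i α β : ℂ) * (pw k (wα uv κ' i) * pw k' (wβ uv κ' i) - 1) := by
  have h0 : ∑ i, (wc κ' i α β : ℂ) = 0 := by
    have h := congrArg (fun r : ℝ => (r : ℂ)) (sum_wc_eq_zero κ' α β)
    push_cast at h
    exact h
  simp only [mul_sub, mul_one, Finset.sum_sub_distrib, h0, sub_zero, wSym, mul_assoc]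


/-! ## §6 Strip bounds -/

/-- [folklore] the plane wave on a strip: `‖pw k x‖ ≤ e^{η·|x|₁}` when `|Im k_μ| ≤ η` for all `μ`. -/
theorem norm_pw_le_exp (k : Fin (d + 1) → ℂ) (x : Fin (d + 1) → ℤ) {η : ℝ} (hk : ∀ μ, |(k μ).im| ≤ η) :
    ‖pw k x‖ ≤ Real.exp (η * l1 x) := by
  unfold pw
  refine (norm_cexp_I_mul_le _).trans (Real.exp_le_exp.2 ?_)
  rw [Complex.im_sum, l1, Finset.mul_sum]
  refine (Finset.abs_sum_le_sum_abs _ _).trans (Finset.sum_le_sum fun μ _ => ?_)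
  have him : (k μ * ((x μ : ℤ) : ℂ)).im = (k μ).im * (x μ : ℝ) := by
    simp [Complex.mul_im]
  rw [him, abs_mul]
  exact mul_le_mul_of_nonneg_right (hk μ) (abs_nonneg _)

/-- [folklore] THE ℓ¹-MASS of the colourless table at `(κ′, α, β)`. -/
def wAbs (κ' α β : Fin (d + 1)) : ℝ := ∑ i, |wc κ' i α β|

/-- [folklore] `0 ≤ wAbs`. -/
theorem wAbs_nonneg (κ' α β : Fin (d + 1)) : 0 ≤ wAbs κ' α β := Finset.sum_nonneg fun _ _ => abs_nonneg _

/-- [folklore] the ℓ¹-mass is dominated by `StepJetData.wBound d` (which sums it over all `(κ′, α, β)`). -/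
theorem wAbs_le_wBound (κ' α β : Fin (d + 1)) : wAbs κ' α β ≤ wBound d := by
  unfold wAbs wBound wc
  have h1 : ∑ i, |wm κ' (1 : Matrix Unit Unit ℝ) i ((), α) ((), β)| ≤
      ∑ b : Unit × Fin (d + 1), ∑ i, |wm κ' (1 : Matrix Unit Unit ℝ) i ((), α) b| :=
    Finset.single_le_sum (f := fun b : Unit × Fin (d + 1) => ∑ i, |wm κ' (1 : Matrix Unit Unit ℝ) i ((), α) b|)
      (fun _ _ => Finset.sum_nonneg fun _ _ => abs_nonneg _) (Finset.mem_univ ((), β))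
  have h2 : ∑ b : Unit × Fin (d + 1), ∑ i, |wm κ' (1 : Matrix Unit Unit ℝ) i ((), α) b| ≤
      ∑ a : Unit × Fin (d + 1), ∑ b : Unit × Fin (d + 1), ∑ i, |wm κ' (1 : Matrix Unit Unit ℝ) i a b| :=
    Finset.single_le_sum (f := fun a : Unit × Fin (d + 1) => ∑ b : Unit × Fin (d + 1), ∑ i, |wm κ' (1 : Matrix Unit Unit ℝ) i a b|)
      (fun _ _ => Finset.sum_nonneg fun _ _ => Finset.sum_nonneg fun _ _ => abs_nonneg _) (Finset.mem_univ ((), α))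
  have h3 : ∑ a : Unit × Fin (d + 1), ∑ b : Unit × Fin (d + 1), ∑ i, |wm κ' (1 : Matrix Unit Unit ℝ) i a b| ≤
      ∑ γ : Fin (d + 1), ∑ a : Unit × Fin (d + 1), ∑ b : Unit × Fin (d + 1), ∑ i, |wm γ (1 : Matrix Unit Unit ℝ) i a b| :=
    Finset.single_le_sum
      (f := fun γ : Fin (d + 1) => ∑ a : Unit × Fin (d + 1), ∑ b : Unit × Fin (d + 1), ∑ i, |wm γ (1 : Matrix Unit Unit ℝ) i a b|)
      (fun _ _ => Finset.sum_nonneg fun _ _ => Finset.sum_nonneg fun _ _ => Finset.sum_nonneg fun _ _ => abs_nonneg _)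
      (Finset.mem_univ κ')
  exact h1.trans (h2.trans h3)

/-- [folklore] **STRIP BOUND OF THE BI-SYMBOL**: on `|Im k_μ| ≤ η`, `|Im k′_μ| ≤ η′`, `‖wSym κ′ α β k k′‖ ≤ wAbs κ′ α β · e^{2η} · e^{2η′}`
(both offsets of every summand have ℓ¹-size ≤ 2, `StepJetData.l1_isOffset_le`). -/
theorem norm_wSym_le (κ' α β : Fin (d + 1)) {k k' : Fin (d + 1) → ℂ} {η η' : ℝ} (hη : 0 ≤ η) (hη' : 0 ≤ η')
    (hk : ∀ μ, |(k μ).im| ≤ η) (hk' : ∀ μ, |(k' μ).im| ≤ η') :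
    ‖wSym κ' α β k k'‖ ≤ wAbs κ' α β * Real.exp (2 * η) * Real.exp (2 * η') := by
  unfold wSym wAbs
  rw [Finset.sum_mul, Finset.sum_mul]
  refine (norm_sum_le _ _).trans (Finset.sum_le_sum fun i _ => ?_)
  rw [norm_mul, norm_mul, Complex.norm_real, Real.norm_eq_abs]
  have hα : l1 (wα uv κ' i) ≤ 2 := l1_isOffset_le (isOffset_wα uv κ' i)
  have hβ : l1 (wβ uv κ' i) ≤ 2 := l1_isOffset_le (isOffset_wβ uv κ' i)
  have h1 : ‖pw k (wα uv κ' i)‖ ≤ Real.exp (2 * η) :=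
    (norm_pw_le_exp k _ hk).trans (Real.exp_le_exp.2 (by nlinarith [l1_nonneg (wα uv κ' i)]))
  have h2 : ‖pw k' (wβ uv κ' i)‖ ≤ Real.exp (2 * η') :=
    (norm_pw_le_exp k' _ hk').trans (Real.exp_le_exp.2 (by nlinarith [l1_nonneg (wβ uv κ' i)]))
  have h3 : |wc κ' i α β| * ‖pw k (wα uv κ' i)‖ ≤ |wc κ' i α β| * Real.exp (2 * η) :=
    mul_le_mul_of_nonneg_left h1 (abs_nonneg _)
  exact mul_le_mul h3 h2 (norm_nonneg _) (mul_nonneg (abs_nonneg _) (Real.exp_pos _).le)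


/-! ## §6b The curl gain at the symbol level: first-order vanishing at `(k, k′) = (0, 0)` with a strip-uniform constant -/

/-- [folklore] the phase of one summand: `pw k a · pw k′ b = e^{i(k·a + k′·b)}`. -/
theorem pw_mul_pw (k k' : Fin (d + 1) → ℂ) (a b : Fin (d + 1) → ℤ) :
    pw k a * pw k' b = cexp (I * (∑ μ, k μ * (a μ : ℂ) + ∑ μ, k' μ * (b μ : ℂ))) := by
  unfold pw
  rw [← Complex.exp_add]
  congr 1
  ring

/-- [folklore] `|Re(k·a)| ≤ ‖k‖·|a|₁` (sup norm of `k`). -/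
theorem abs_re_dot_le (k : Fin (d + 1) → ℂ) (a : Fin (d + 1) → ℤ) : |(∑ μ, k μ * (a μ : ℂ)).re| ≤ ‖k‖ * l1 a := by
  rw [Complex.re_sum, l1, Finset.mul_sum]
  refine (Finset.abs_sum_le_sum_abs _ _).trans (Finset.sum_le_sum fun μ _ => ?_)
  have h : (k μ * ((a μ : ℤ) : ℂ)).re = (k μ).re * (a μ : ℝ) := by simp [Complex.mul_re]
  rw [h, abs_mul]
  exact mul_le_mul_of_nonneg_right ((Complex.abs_re_le_norm _).trans (norm_le_pi_norm k μ)) (abs_nonneg _)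

/-- [folklore] `|Im(k·a)| ≤ ‖k‖·|a|₁`. -/
theorem abs_im_dot_le (k : Fin (d + 1) → ℂ) (a : Fin (d + 1) → ℤ) : |(∑ μ, k μ * (a μ : ℂ)).im| ≤ ‖k‖ * l1 a := by
  rw [Complex.im_sum, l1, Finset.mul_sum]
  refine (Finset.abs_sum_le_sum_abs _ _).trans (Finset.sum_le_sum fun μ _ => ?_)
  have h : (k μ * ((a μ : ℤ) : ℂ)).im = (k μ).im * (a μ : ℝ) := by simp [Complex.mul_im]
  rw [h, abs_mul]
  exact mul_le_mul_of_nonneg_right ((Complex.abs_im_le_norm _).trans (norm_le_pi_norm k μ)) (abs_nonneg _)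

/-- [folklore] `|Im(k·a)| ≤ η·|a|₁` on the strip `|Im k_μ| ≤ η`. -/
theorem abs_im_dot_le_strip (k : Fin (d + 1) → ℂ) (a : Fin (d + 1) → ℤ) {η : ℝ} (hk : ∀ μ, |(k μ).im| ≤ η) :
    |(∑ μ, k μ * (a μ : ℂ)).im| ≤ η * l1 a := by
  rw [Complex.im_sum, l1, Finset.mul_sum]
  refine (Finset.abs_sum_le_sum_abs _ _).trans (Finset.sum_le_sum fun μ _ => ?_)
  have h : (k μ * ((a μ : ℤ) : ℂ)).im = (k μ).im * (a μ : ℝ) := by simp [Complex.mul_im]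
  rw [h, abs_mul]
  exact mul_le_mul_of_nonneg_right (hk μ) (abs_nonneg _)

/-- [folklore] **ONE EXPONENTIAL DIFFERENCE IS FIRST ORDER IN THE MOMENTA**: on `|Im k_μ| ≤ η`, `|Im k′_μ| ≤ η′`,
`‖pw k a · pw k′ b − 1‖ ≤ 2(‖k‖·|a|₁ + ‖k′‖·|b|₁)·e^{η|a|₁ + η′|b|₁}` (`AliasStripSymbols.norm_cexp_I_mul_sub_one_le'`). -/
theorem norm_pw_mul_pw_sub_one_le (k k' : Fin (d + 1) → ℂ) (a b : Fin (d + 1) → ℤ) {η η' : ℝ}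
    (hk : ∀ μ, |(k μ).im| ≤ η) (hk' : ∀ μ, |(k' μ).im| ≤ η') :
    ‖pw k a * pw k' b - 1‖ ≤ 2 * (‖k‖ * l1 a + ‖k'‖ * l1 b) * Real.exp (η * l1 a + η' * l1 b) := by
  rw [pw_mul_pw]
  refine (Summit.QuantumFields.BalabanUV.Beta.GAN24.AliasStripSymbols.norm_cexp_I_mul_sub_one_le' _).trans ?_
  have hre : |(∑ μ, k μ * (a μ : ℂ) + ∑ μ, k' μ * (b μ : ℂ)).re| ≤ ‖k‖ * l1 a + ‖k'‖ * l1 b := by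
    rw [Complex.add_re]
    exact (abs_add_le _ _).trans (add_le_add (abs_re_dot_le k a) (abs_re_dot_le k' b))
  have him : |(∑ μ, k μ * (a μ : ℂ) + ∑ μ, k' μ * (b μ : ℂ)).im| ≤ ‖k‖ * l1 a + ‖k'‖ * l1 b := by
    rw [Complex.add_im]
    exact (abs_add_le _ _).trans (add_le_add (abs_im_dot_le k a) (abs_im_dot_le k' b))
  have him' : |(∑ μ, k μ * (a μ : ℂ) + ∑ μ, k' μ * (b μ : ℂ)).im| ≤ η * l1 a + η' * l1 b := by
    rw [Complex.add_im]
    exact (abs_add_le _ _).trans (add_le_add (abs_im_dot_le_strip k a hk) (abs_im_dot_le_strip k' b hk'))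
  have hnn : 0 ≤ ‖k‖ * l1 a + ‖k'‖ * l1 b := by
    have := l1_nonneg a; have := l1_nonneg b; positivity
  exact mul_le_mul (by linarith) (Real.exp_le_exp.2 him') (Real.exp_pos _).le (by linarith)

/-- [folklore] **THE CURL GAIN AT THE SYMBOL LEVEL**: on `|Im k_μ| ≤ η`, `|Im k′_μ| ≤ η′` (`η, η′ ≥ 0`),
`‖wSym κ′ α β k k′‖ ≤ 4·wAbs κ′ α β·(‖k‖ + ‖k′‖)·e^{2η + 2η′}` — first order in the pair of momenta, uniformly on the strip (every
offset has ℓ¹-size ≤ 2).  On the zero alias `k = p∕N`, `k′ = p′∕N` this is the ONE factor `N⁻¹` of (PC-2)'s power count. -/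
theorem norm_wSym_le_linear (κ' α β : Fin (d + 1)) {k k' : Fin (d + 1) → ℂ} {η η' : ℝ} (hη : 0 ≤ η) (hη' : 0 ≤ η')
    (hk : ∀ μ, |(k μ).im| ≤ η) (hk' : ∀ μ, |(k' μ).im| ≤ η') :
    ‖wSym κ' α β k k'‖ ≤ 4 * wAbs κ' α β * (‖k‖ + ‖k'‖) * Real.exp (2 * η + 2 * η') := by
  rw [wSym_eq_sum_sub_one, wAbs, Finset.mul_sum, Finset.sum_mul, Finset.sum_mul]
  refine (norm_sum_le _ _).trans (Finset.sum_le_sum fun i _ => ?_)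
  rw [norm_mul, Complex.norm_real, Real.norm_eq_abs]
  have hα : l1 (wα uv κ' i) ≤ 2 := l1_isOffset_le (isOffset_wα uv κ' i)
  have hβ : l1 (wβ uv κ' i) ≤ 2 := l1_isOffset_le (isOffset_wβ uv κ' i)
  have hα0 := l1_nonneg (wα uv κ' i)
  have hβ0 := l1_nonneg (wβ uv κ' i)
  have h1 := norm_pw_mul_pw_sub_one_le k k' (wα uv κ' i) (wβ uv κ' i) hk hk'
  have h2 : 2 * (‖k‖ * l1 (wα uv κ' i) + ‖k'‖ * l1 (wβ uv κ' i)) * Real.exp (η * l1 (wα uv κ' i) + η' * l1 (wβ uv κ' i)) ≤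
      4 * (‖k‖ + ‖k'‖) * Real.exp (2 * η + 2 * η') := by
    have hk0 := norm_nonneg k
    have hk0' := norm_nonneg k'
    refine mul_le_mul ?_ (Real.exp_le_exp.2 (by nlinarith)) (Real.exp_pos _).le (by positivity)
    nlinarith
  calc |wc κ' i α β| * ‖pw k (wα uv κ' i) * pw k' (wβ uv κ' i) - 1‖
      ≤ |wc κ' i α β| * (4 * (‖k‖ + ‖k'‖) * Real.exp (2 * η + 2 * η')) :=
        mul_le_mul_of_nonneg_left (h1.trans h2) (abs_nonneg _)
    _ = 4 * |wc κ' i α β| * (‖k‖ + ‖k'‖) * Real.exp (2 * η + 2 * η') := by ring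

end Summit.QuantumFields.BalabanUV.Beta.GAN24.WilsonVertexSymbol

end
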